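import Mathlib
import HarnessLib
import Literature.MathematicalPhysics.StatisticalMechanics.RenormalisationMapFreeHtKernelWeak
import Literature.MathematicalPhysics.StatisticalMechanics.AbkmPackageLargeSetMargin
import Literature.MathematicalPhysics.StatisticalMechanics.AbkmPackagePairSuppliers
import Literature.MathematicalPhysics.StatisticalMechanics.NextHamiltonianKernelSubTorusFRD
import Summits.HubbardSuperconductivity.HubbardSuperconductivity.Theorems.ComplexGFFStiffnessPolynomialGeometricAbsorption
import Literature.MathematicalPhysics.StatisticalMechanics.AbkmPackageLargeSetSlack
import Literature.MathematicalPhysics.StatisticalMechanics.AbkmPackageNextHTwoKernel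
import Literature.MathematicalPhysics.StatisticalMechanics.AbkmPackageLocalSlots
import Literature.MathematicalPhysics.StatisticalMechanics.RenormalisationMapBallActivityABKMQ
import Summits.HubbardSuperconductivity.HubbardSuperconductivity.Theorems.ComplexGFFStiffnessHolomorphicPackageLines

/-!
# Crux child `TwoKernelSkBound` (stmt-HubbardSuperconductivity-27414), line `banach_two_kernel`, stub `stub_f4l2ShrinkLoc` —
# block U2 at PACKAGE level: two step kernels at a COMMON FREE intermediate Hamiltonian, `N`-free

Route `route-HubbardSuperconductivity-ComplexGFFStiffness`, cruxes stmt-…-19154 `HypACumulant` / stmt-…-19155 `HypALocalTwoPoint`;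
memo `Cruxes/HypACumulant/TWOKERNEL-PLAN-27414-v3.md` §2 (R2).  For every [ABKM19] package `P` with `0 < P.r` there are `N`-FREE
`l₂ ≥ 0`, `ρ₀ > 0`, `T₁ > 0` such that at every height, for `q, q'` in the ball with `|q − q'|₁ ≤ T₁`, every step `k + 1 ≤ N`, every
state `(u, v)` in the `P.r`-ball and every `H̃` with `‖H̃ − H̃_q‖_{k,0} ≤ ρ₀` (`H̃_q = nextH D_q (toHam u) (mulExt v)`):
`‖nextK(μ_q; e^{−toHam u}, e^{−H̃}, mulExt v) − nextK(μ_{q'}; e^{−toHam u}, e^{−H̃}, mulExt v)‖_{k+1}^{(A)} ≤ l₂ |q − q'|₁ max(‖u‖, c_v)`.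
Package discharge of the kernel-level bound `weakNormLE_nextK_freeHt_kernel_sub_abkm_of_stepKernelBounds` (p832273), verbatim the
discharge of stub 1 (`twoKernelNextKStepLoc_all`: pair suppliers of Lemma 8.4, room `κ(r)/κ_mid`, geometric absorption of the
near-`U` polynomial, `‖H̃_q − H̃_{q'}‖ ≤ ℓ_H|q−q'|₁ max(‖u‖,c_v)` for the defect twin) with the letter `τ' = τ_r + ρ₀` for the free `H̃`
(`ρ₀ = min(1/64, τ_r)`).  This is the uniform bound (U2) consumed by the Cauchy estimate of blocks B2/B3.  All proved, no `sorry`.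
Honest scope: rung route (stiffness of a complex Gaussian gradient field via the [ABKM19] RG); nothing about superconductivity in the
Hubbard model.

## References
* S. Adams, S. Buchholz, R. Kotecký, S. Müller, arXiv:1910.13564, Theorem 6.8, Lemma 8.4, Lemma 9.3, Ch. 12 (12.4), Lemma 12.6 (12.53)
  [AdamsBuchholzKoteckyMuller2019].
-/

noncomputable section

-- `Summit.<Summit>.<Problem>`: single-conjunct summit, the duplicate component is mandated (D-0017).
set_option linter.dupNamespace false

namespace Summit.HubbardSuperconductivity.HubbardSuperconductivity.Theorems.ComplexGFF

open scoped BigOperators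
open Finset
open Literature.MathematicalPhysics.StatisticalMechanics.GradientRG
open Literature.MathematicalPhysics.StatisticalMechanics.TorusPolymer
  (IsPolymer blockOf blocks numBlocks thicken reblock card_blocks_eq_numBlocks)
open Literature.Barriers.CriticalPhenomena.LongRangePhi4.Polymer (IsConn)
open Literature.MathematicalPhysics.StatisticalMechanics
open Literature.MathematicalPhysics.QuantumFieldTheory

variable {d : ℕ}

/-- `√(3^{d+1}(2(Lu + c₀))^d)·λ^u ≤ 1 + 3^{d+1}(2L)^d C₁` when `(u + c₀)^d λ^u ≤ C₁` (plumbing, copy of the private lemma of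
`…TwoKernelNextKStepLoc`). -/
private theorem sqrt_poly_mul_geom_le_freeHt {L n : ℕ} {c₀ lamR C₁ : ℝ} (hL1 : 1 ≤ L) (hc₀ : 0 ≤ c₀)
    (hlam0 : 0 ≤ lamR) (hlam1 : lamR ≤ 1) (hC₁ : ∀ m : ℕ, ((m : ℝ) + c₀) ^ n * lamR ^ m ≤ C₁) (u : ℕ) :
    Real.sqrt ((3 : ℝ) ^ (n + 1) * (2 * ((L : ℝ) * u + c₀)) ^ n) * lamR ^ u ≤
      1 + (3 : ℝ) ^ (n + 1) * ((2 * (L : ℝ)) ^ n * C₁) := by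
  have hy0 : 0 ≤ (3 : ℝ) ^ (n + 1) * (2 * ((L : ℝ) * u + c₀)) ^ n := by positivity
  have hlamu1 : lamR ^ u ≤ 1 := pow_le_one₀ hlam0 hlam1
  have hlamu0 : 0 ≤ lamR ^ u := pow_nonneg hlam0 _
  have hsqrt : Real.sqrt ((3 : ℝ) ^ (n + 1) * (2 * ((L : ℝ) * u + c₀)) ^ n) ≤
      1 + (3 : ℝ) ^ (n + 1) * (2 * ((L : ℝ) * u + c₀)) ^ n := by
    calc Real.sqrt ((3 : ℝ) ^ (n + 1) * (2 * ((L : ℝ) * u + c₀)) ^ n)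
        ≤ Real.sqrt ((1 + (3 : ℝ) ^ (n + 1) * (2 * ((L : ℝ) * u + c₀)) ^ n) ^ 2) :=
          Real.sqrt_le_sqrt (by nlinarith)
      _ = 1 + (3 : ℝ) ^ (n + 1) * (2 * ((L : ℝ) * u + c₀)) ^ n := Real.sqrt_sq (by positivity)
  have hL1r : (1 : ℝ) ≤ L := by exact_mod_cast hL1
  have hcL : c₀ ≤ (L : ℝ) * c₀ := le_mul_of_one_le_left hc₀ hL1r
  have hbase : 2 * ((L : ℝ) * u + c₀) ≤ 2 * (L : ℝ) * ((u : ℝ) + c₀) := by nlinarith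
  have hyle : (3 : ℝ) ^ (n + 1) * (2 * ((L : ℝ) * u + c₀)) ^ n ≤
      (3 : ℝ) ^ (n + 1) * ((2 * (L : ℝ)) ^ n * (((u : ℝ) + c₀) ^ n)) := by
    rw [← mul_pow]
    exact mul_le_mul_of_nonneg_left (pow_le_pow_left₀ (by positivity) hbase n) (by positivity)
  have hmain : (3 : ℝ) ^ (n + 1) * (2 * ((L : ℝ) * u + c₀)) ^ n * lamR ^ u ≤
      (3 : ℝ) ^ (n + 1) * ((2 * (L : ℝ)) ^ n * C₁) := by
    calc (3 : ℝ) ^ (n + 1) * (2 * ((L : ℝ) * u + c₀)) ^ n * lamR ^ u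
        ≤ (3 : ℝ) ^ (n + 1) * ((2 * (L : ℝ)) ^ n * (((u : ℝ) + c₀) ^ n)) * lamR ^ u :=
          mul_le_mul_of_nonneg_right hyle hlamu0
      _ = (3 : ℝ) ^ (n + 1) * ((2 * (L : ℝ)) ^ n * ((((u : ℝ) + c₀) ^ n) * lamR ^ u)) := by ring
      _ ≤ (3 : ℝ) ^ (n + 1) * ((2 * (L : ℝ)) ^ n * C₁) :=
          mul_le_mul_of_nonneg_left (mul_le_mul_of_nonneg_left (hC₁ u) (by positivity)) (by positivity)
  calc Real.sqrt ((3 : ℝ) ^ (n + 1) * (2 * ((L : ℝ) * u + c₀)) ^ n) * lamR ^ u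
      ≤ (1 + (3 : ℝ) ^ (n + 1) * (2 * ((L : ℝ) * u + c₀)) ^ n) * lamR ^ u :=
        mul_le_mul_of_nonneg_right hsqrt hlamu0
    _ = lamR ^ u + (3 : ℝ) ^ (n + 1) * (2 * ((L : ℝ) * u + c₀)) ^ n * lamR ^ u := by ring
    _ ≤ 1 + (3 : ℝ) ^ (n + 1) * ((2 * (L : ℝ)) ^ n * C₁) := add_le_add hlamu1 hmain

set_option maxHeartbeats 3200000 in
/-- **Block U2 (package level): the two-kernel comparison of `K_{k+1}` at a COMMON FREE intermediate Hamiltonian, `N`-free**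
(module docstring). [cite: AdamsBuchholzKoteckyMuller2019, Lemma 12.6 (12.53) / Theorem 6.8 / Lemma 8.4] -/
theorem exists_weakNormLE_nextK_freeHt_kernel_sub (P : PackageData d) [Fact (0 < P.h)] [Fact (0 < P.L)] (hr0 : 0 < P.r) :
    ∃ l₂ ρ₀ T₁ : ℝ, 0 ≤ l₂ ∧ 0 < ρ₀ ∧ 0 < T₁ ∧ ∀ (N M : ℕ) [NeZero M] (Q : PackageAt P N M),
      ∀ q q' : Matrix (Fin d) (Fin d) ℝ, P.InBall q → P.InBall q' → esum (q - q') ≤ T₁ → ∀ k, k + 1 ≤ N →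
      ∀ (u : HamSpace ℂ d (fieldWt P.h (P.L : ℝ) d k) ((P.L : ℝ) ^ k) (P.L ^ (d * k)))
        (v : activitySpace Q.normParams k) (cv : ℝ), ‖u‖ ≤ P.r →
        activityNormLE Q.normParams k v cv → cv ≤ P.r →
      ∀ Ht : RelevantHamiltonian ℂ d,
        hamNorm (fieldWt P.h (P.L : ℝ) d k) ((P.L : ℝ) ^ k) (P.L ^ (d * k))
          (Ht - nextH (abkmStepData P.L P.R k (Q.kernels q)) (HamSpace.toHam u)
            (mulExt ((v : activitySpace Q.normParams k) :
              Finset (Fin d → ZMod M) → ((Fin d → ZMod M) → ℝ) → ℂ))) ≤ ρ₀ →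
        WeakNormLE Q.normParams (k + 1)
          (fun U φ =>
            nextK (abkmStepData P.L P.R k (Q.kernels q)).s (reblock (abkmStepData P.L P.R k (Q.kernels q)).s ((abkmStepData P.L P.R k (Q.kernels q)).L * (abkmStepData P.L P.R k (Q.kernels q)).s)) (stepMeasure (abkmStepData P.L P.R k (Q.kernels q)).𝒞)
                (expNegH (HamSpace.toHam u)) (expNegH Ht)
                (mulExt ((v : activitySpace Q.normParams k) :
              Finset (Fin d → ZMod M) → ((Fin d → ZMod M) → ℝ) → ℂ)) U φ -
              nextK (abkmStepData P.L P.R k (Q.kernels q')).s (reblock (abkmStepData P.L P.R k (Q.kernels q')).s ((abkmStepData P.L P.R k (Q.kernels q')).L * (abkmStepData P.L P.R k (Q.kernels q')).s)) (stepMeasure (abkmStepData P.L P.R k (Q.kernels q')).𝒞)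
                (expNegH (HamSpace.toHam u)) (expNegH Ht)
                (mulExt ((v : activitySpace Q.normParams k) :
              Finset (Fin d → ZMod M) → ((Fin d → ZMod M) → ℝ) → ℂ)) U φ)
          (l₂ * esum (q - q') * max ‖u‖ cv) := by
  -- the `N`-free size of `H̃_q − H̃_{q'}`
  obtain ⟨ℓH, hℓH0, hnextH⟩ := P.exists_hamNorm_nextH_sub
  -- letters of the package
  set C87 := pi2BoundConst d (((2 * P.R + 2 : ℕ) : ℝ) + ((d / 2 + 1 : ℕ) : ℝ)) with hC87
  have hC87_0 : 0 ≤ C87 := pi2BoundConst_nonneg d (by positivity)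
  have hA0 : 0 < P.A := lt_of_lt_of_le one_pos P.hA1
  have hA𝒫0 : 0 ≤ P.A𝒫' := P.A𝒫'_nonneg
  set vr := vABKM d P.R P.A P.A𝒫' P.r with hvr
  have hvr' : vr = C87 * (P.r * P.A𝒫' * P.A⁻¹) := rfl
  have hvr0 : 0 ≤ vr := by rw [hvr']; exact mul_nonneg hC87_0 (by positivity)
  set τ := 2 * P.r + vr with hτdef
  have hτ0 : 0 < τ := by positivity
  have hτ364 : τ ≤ 3 / 64 := by
    have h1 : P.r ≤ 1 / 64 := P.hr
    have h2 : vr ≤ 1 / 64 := P.hv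
    rw [hτdef]; linarith
  set ρ₀ : ℝ := min (1 / 64) τ with hρ₀def
  have hρ₀0 : 0 < ρ₀ := lt_min (by norm_num) hτ0
  have hρ₀τ : ρ₀ ≤ τ := min_le_right _ _
  have hρ₀64 : ρ₀ ≤ 1 / 64 := min_le_left _ _
  set s := 16 * Real.exp (3 / 8) * τ with hsdef
  have hs0 : 0 < s := by positivity
  set κb := 1 + Real.exp (1 / 4) with hκbdef
  have hκb1 : 1 ≤ κb := by have := Real.exp_pos (1 / 4 : ℝ); linarith
  set κm := κb + s with hκmdef
  have hκm0 : 0 < κm := by linarith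
  have hκA : kappaABKM d P.R P.A P.A𝒫' P.r = κm + s := by
    rw [hκmdef, hκbdef, hsdef, hτdef, hvr, kappaABKM_eq_mid_add]
  set κA := kappaABKM d P.R P.A P.A𝒫' P.r with hκAdef
  have hκA0 : 0 < κA := by rw [hκA]; linarith
  have hκmA : κm ≤ κA := by rw [hκA]; linarith
  set ω := omegaABKM d P.R P.A P.A𝒫' P.r with hωdef
  have hω : ω = 8 * Real.exp (1 / 4) * τ + 2 * s := by
    rw [hωdef, hsdef, hτdef, hvr]; unfold omegaABKM; ring
  -- the room parameter `ε` and the pair suppliers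
  set ε := s / (4 * (κb + s)) with hεdef
  have hε0 : 0 < ε := by positivity
  have hκmε : κm * ε = s / 4 := by
    rw [hεdef, hκmdef]; field_simp
  have hε1 : ε ≤ 1 / 4 := by
    rw [hεdef, div_le_iff₀ (by positivity)]; nlinarith only [hs0, hκb1]
  obtain ⟨ℓc, ℓn, κp, hℓc0, hℓn0, hκp0, hκpε, hsup⟩ := P.exists_pairSuppliers hε0
  set κc := (1 + ε) * κp with hκcdef
  have hκc0 : 0 ≤ κc := by positivity
  have hκcle : κc ≤ (2 : ℝ) ^ (d + 1) * max 1 P.A𝒫' := by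
    have h1 : κc ≤ (1 + ε) * ((1 + ε) * P.A𝒫') := mul_le_mul_of_nonneg_left hκpε (by positivity)
    have h2 : (1 + ε) * ((1 + ε) * P.A𝒫') ≤ 4 * max 1 P.A𝒫' := by
      have hm : P.A𝒫' ≤ max 1 P.A𝒫' := le_max_right _ _
      have hm0 : 0 ≤ max 1 P.A𝒫' := le_trans zero_le_one (le_max_left _ _)
      have h16 : (1 + ε) * (1 + ε) ≤ 4 := by nlinarith only [hε0, hε1]
      calc (1 + ε) * ((1 + ε) * P.A𝒫') = ((1 + ε) * (1 + ε)) * P.A𝒫' := by ring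
        _ ≤ 4 * max 1 P.A𝒫' := mul_le_mul h16 hm hA𝒫0 (by norm_num)
    have h3 : (4 : ℝ) ≤ 2 ^ (d + 1) := by
      have : (2 : ℝ) ^ 2 ≤ 2 ^ (d + 1) := pow_le_pow_right₀ (by norm_num) (by have := P.hd; omega)
      norm_num at this; linarith
    calc κc ≤ 4 * max 1 P.A𝒫' := h1.trans h2
      _ ≤ 2 ^ (d + 1) * max 1 P.A𝒫' :=
        mul_le_mul_of_nonneg_right h3 (le_trans zero_le_one (le_max_left _ _))
  have hκcA : κc ≤ P.A := P.kappa'_le_A hκc0 hκcle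
  have hsmallc := P.hsmall_margin hκc0 hκcle
  -- the geometric room `lam₀ = κ_mid (1+ε) / κ_A < 1` and `lamR = lam₀^{cL^d}`
  set lam₀ := κm * (1 + ε) / κA with hlam₀def
  have hlam₀0 : 0 < lam₀ := by positivity
  have hlam₀1 : lam₀ < 1 := by
    rw [hlam₀def, div_lt_one hκA0, hκA]; nlinarith only [hκmε, hs0, hκm0]
  have hlamκ : lam₀ * κA = κm * (1 + ε) := by
    rw [hlam₀def]; field_simp
  set cN := (2 ^ (d + 1) + 2) ^ d * P.L ^ d with hcNdef
  have hcN1 : 1 ≤ cN := Nat.one_le_iff_ne_zero.2 (mul_ne_zero (pow_ne_zero _ (by positivity)) (pow_ne_zero _ P.hLodd.pos.ne'))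
  set lamR := lam₀ ^ cN with hlamRdef
  have hlamR0 : 0 < lamR := pow_pos hlam₀0 _
  have hlamR1 : lamR < 1 := pow_lt_one₀ hlam₀0.le hlam₀1 (by omega)
  -- the counting conditions at the smaller letter `κ_mid`
  have hmm1 : κm * max 1 P.A𝒫' ≤ κA * max 1 P.A𝒫' :=
    mul_le_mul_of_nonneg_right hκmA (le_trans zero_le_one (le_max_left _ _))
  have hc3a := P.hc3A_of_le hκm0.le hκmA hmm1
  have hc2a := P.hc2A_of_le hκm0.le hκmA hmm1
  have hmm2 : κm * max 1 (max P.A𝒫' κp) ≤ lam₀ * (κA * max 1 P.A𝒫') := by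
    have hm0 : 0 ≤ max 1 P.A𝒫' := le_trans zero_le_one (le_max_left _ _)
    have h1 : max 1 (max P.A𝒫' κp) ≤ (1 + ε) * max 1 P.A𝒫' := by
      refine max_le ?_ (max_le ?_ ?_)
      · have : (1 : ℝ) ≤ max 1 P.A𝒫' := le_max_left _ _
        nlinarith only [this, hε0]
      · have : P.A𝒫' ≤ max 1 P.A𝒫' := le_max_right _ _
        nlinarith only [this, hε0, hA𝒫0]
      · have : P.A𝒫' ≤ max 1 P.A𝒫' := le_max_right _ _
        nlinarith only [this, hε0, hA𝒫0, hκpε, hm0]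
    calc κm * max 1 (max P.A𝒫' κp) ≤ κm * ((1 + ε) * max 1 P.A𝒫') :=
          mul_le_mul_of_nonneg_left h1 hκm0.le
      _ = lam₀ * (κA * max 1 P.A𝒫') := by rw [← mul_assoc, ← hlamκ]; ring
  have hc3b : κm ^ (P.L ^ d) * ((2 * (2 * κm * max 1 (max P.A𝒫' κp))) ^ ((2 ^ (d + 1) + 2) ^ d * P.L ^ d) * (4 : ℝ) ^ ((2 ^ (d + 1) + 2) ^ d * P.L ^ d)) ≤ lamR * P.A ^ ((1 + 1 / ((2 * (2 ^ d + 1) + 6 : ℝ) ^ d)) - 1 : ℝ) := (c3Const_ratio hκm0.le hκmA hmm2 _ _).trans (mul_le_mul_of_nonneg_left P.hc3A (pow_nonneg hlam₀0.le _))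
  have hc2b : κm ^ (P.L ^ d) * ((2 * κm * max 1 (max P.A𝒫' κp)) ^ ((2 ^ (d + 1) + 2) ^ d * P.L ^ d) * (2 : ℝ) ^ ((2 ^ (d + 1) + 2) ^ d * P.L ^ d)) ≤ lamR * P.A ^ ((1 + 1 / ((2 * (2 ^ d + 1) + 6 : ℝ) ^ d)) - 1 : ℝ) := (c2Const_ratio hκm0.le hκmA hmm2 _ _).trans (mul_le_mul_of_nonneg_left P.hc2A (pow_nonneg hlam₀0.le _))
  -- the polynomial of the near supplier is absorbed by `lamR^{|U|_{k+1}}`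
  set c₀ : ℝ := ((2 * (2 ^ (d + 1) + P.R) + 2 * P.pT + 1 : ℕ) : ℝ) with hc₀def
  have hc₀0 : 0 ≤ c₀ := Nat.cast_nonneg _
  obtain ⟨C₁, hC₁0, hC₁⟩ := exists_nat_add_pow_mul_pow_le hlamR0 hlamR1 hc₀0 d
  set Cn : ℝ := 1 + (3 : ℝ) ^ (d + 1) * ((2 * (P.L : ℝ)) ^ d * C₁) with hCndef
  have hCn0 : 0 ≤ Cn := by positivity
  set Cγ := secondDiffConst (fun α => P.Cα α 1) with hCγdef
  have hCγ0 : 0 ≤ Cγ := secondDiffConst_nonneg _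
  -- the threshold and the size
  set T₁ : ℝ := 2 / (ℓH + 1) with hT₁def
  have hT₁0 : 0 < T₁ := by positivity
  have hℓHT₁ : ℓH * T₁ ≤ 2 := by
    rw [hT₁def, mul_div_assoc', div_le_iff₀ (by positivity)]; nlinarith only [hℓH0]
  have hLpos : 0 < P.L := P.hLodd.pos
  have hL0r : (0 : ℝ) < P.L := by exact_mod_cast hLpos
  have hcc0 : 0 ≤ abkmContrConst d P.L P.R := by
    unfold abkmContrConst
    exact mul_nonneg (by norm_num) (blockContrConst_nonneg d one_pos (scaleRatio_pos hLpos).le zero_le_one hL0r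
      hL0r (scaleRatio_pos hLpos).le (Nat.cast_nonneg _) (by positivity))
  have hlpe0 : 0 ≤ largePartEps d P.L P.A κc (1 + 1 / ((2 * (2 ^ d + 1) + 6 : ℝ) ^ d)) :=
    largePartEps_nonneg d P.L hA0.le hκc0
  have hAinv0 : 0 ≤ P.A⁻¹ := inv_nonneg.2 hA0.le
  have hh20 : 0 ≤ P.h ^ 2 := pow_nonneg P.hh.le 2
  have hh2inv : 0 ≤ (P.h ^ 2)⁻¹ := inv_nonneg.2 hh20
  have hℓH1inv : 0 ≤ (ℓH + 1)⁻¹ := inv_nonneg.2 (by positivity)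
  have hω0 : 0 ≤ ω := by rw [hω]; positivity
  set lN : ℝ := ((P.L : ℝ) ^ d * (ℓc * κc * abkmContrConst d P.L P.R) + ℓc * largePartEps d P.L P.A κc (1 + 1 / ((2 * (2 ^ d + 1) + 6 : ℝ) ^ d)) + ℓc * largePartEps d P.L P.A κc (1 + 1 / ((2 * (2 ^ d + 1) + 6 : ℝ) ^ d))) + ((P.L ^ d : ℕ) : ℝ) * κA ^ (P.L ^ d) * (16 * Real.exp (3 / 8) * (τ + ρ₀) * ((1 + 8 * C87) * (ℓc * κc * P.A⁻¹)) + (512 * Real.exp (1 / 4) * (P.r * (C87 * (ℓc * κc * P.A⁻¹))) + 256 * Real.exp (1 / 4) * (C87 * (P.r * P.A𝒫' * P.A⁻¹) + C87 * (P.r * (ℓc * T₁) * κc * P.A⁻¹)) * (C87 * (ℓc * κc * P.A⁻¹)) + (8 * Real.exp (1 / 4) * ℓc * κc + 16 * Real.exp (3 / 8) * (Cγ / P.h ^ 2) + 256 * Real.exp (1 / 4) * (2 * (Cγ / P.h ^ 2)) * (C87 * (P.r * P.A𝒫' * P.A⁻¹))))) * P.A + ℓn * Cn * ((8 * Real.exp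 (1 / 4) + 1) * (ω * P.A ^ 4) + 1) + ℓn * Cn * ((8 * Real.exp (1 / 4) + 1) * (ω * P.A ^ 4)) + ℓn * Cn * ((8 * Real.exp (1 / 4) + 1) * (ω * P.A ^ 4)) + ((P.L ^ d : ℕ) : ℝ) * κA ^ (P.L ^ d) * (16 * Real.exp (3 / 8) * ℓH) * P.A with hlNdef
  have hlN0 : 0 ≤ lN := by
    rw [hlNdef]
    apply_rules (maxDepth := 4000) [hAinv0, hA0.le, hτ0.le, hρ₀0.le, hκA0.le, hω0, hℓc0, hκc0, hC87_0, hCγ0, hA𝒫0,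
      P.hr0, hh20, hh2inv, hℓH0, hℓH1inv, hℓn0, hCn0, hT₁0.le, hcc0, hlpe0, hκp0, Nat.cast_nonneg, Nat.ofNat_nonneg,
      zero_le_one, Real.exp_nonneg, add_nonneg, mul_nonneg, pow_nonneg, div_nonneg, sq_nonneg]
  refine ⟨lN, ρ₀, T₁, hlN0, hρ₀0, hT₁0, fun N M _ Q => ?_⟩
  intro q q' hq hq' hT k hk u v cv hu hv hcv Ht hHt
  -- sizes
  have hd2 : 2 ≤ d := le_trans (by norm_num) P.hd
  have hL1 : 1 ≤ P.L := P.hLodd.pos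
  have hPA : 0 < Q.normParams.A := P.A_pos
  have hk1 : 1 ≤ P.L ^ k := Nat.one_le_pow _ _ P.hLodd.pos
  have hkN1 : k + 1 ≤ N + 1 := by omega
  have hMt : M = Q.normParams.L ^ k * P.L ^ (N - k) := by
    show M = P.L ^ k * P.L ^ (N - k)
    rw [Q.hM, ← pow_add, Nat.add_sub_cancel' (by omega)]
  have hcv0 : 0 ≤ cv := nonneg_of_weakNormLE hPA hMt P.hLodd.pow P.hLodd.pow hv
  have hq2 : ∑ i, ∑ j, |q i j| ≤ 1 / 2 := hq.2.trans P.hT₀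
  have hq'2 : ∑ i, ∑ j, |q' i j| ≤ 1 / 2 := hq'.2.trans P.hT₀
  set T := esum (q - q') with hTdef
  have hT0 : 0 ≤ T := entrySum_nonneg _
  set mx := max ‖u‖ cv with hmxdef
  have hmx0 : 0 ≤ mx := le_max_of_le_left (norm_nonneg _)
  have hmxr : mx ≤ P.r := max_le hu hcv
  have hm64 : mx ≤ 1 / 64 := hmxr.trans P.hr
  -- the state
  set H := HamSpace.toHam u with hHdef
  set Kf := mulExt ((v : activitySpace Q.normParams k) :
    Finset (Fin d → ZMod M) → ((Fin d → ZMod M) → ℝ) → ℂ) with hKfdef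
  have hnormu : hamNorm (fieldWt P.h (P.L : ℝ) d k) ((P.L : ℝ) ^ k) (P.L ^ (d * k)) H = ‖u‖ := by
    rw [hHdef, HamSpace.norm_def]
  have hHm : hamNorm (fieldWt P.h (P.L : ℝ) d k) ((P.L : ℝ) ^ k) (P.L ^ (d * k)) H ≤ mx := by
    rw [hnormu]; exact le_max_left _ _
  have hKw : WeakNormLE Q.normParams k Kf cv := activitySpace.weakNormLE_mulExt v hv
  have hKm : WeakNormLE Q.normParams k Kf mx := hKw.mono hPA (le_max_right _ _)
  have hKd : ∀ Y, ContDiff ℝ P.r₀ (Kf Y) := activitySpace.contDiff_mulExt v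
  have hKloc : ∀ Y, IsPolymer (P.L ^ k) Y → IsConn Y → IsGaugeLocal (Q.normParams.gauge k Y) (Kf Y) :=
    fun Y hY hYc => activitySpace.isGaugeLocal_mulExt v hY hYc
  have hKt : TransInv (P.L ^ k) Kf := activitySpace.transInv_mulExt v
  -- the two step data
  have hSa := packageAt_stepKernelBounds P Q hq hk
  have hSb := packageAt_stepKernelBounds P Q hq' hk
  set Da := abkmStepData P.L P.R k (Q.kernels q) with hDa
  set Db := abkmStepData P.L P.R k (Q.kernels q') with hDb
  -- `L^{dk}|γ(q) − γ(q')| ≤ C_γ |q − q'|₁`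
  have hγab : ∀ p : quadIndex d, ((P.L ^ (d * k) : ℕ) : ℝ) * |gradCov Da.𝒞 p - gradCov Db.𝒞 p| ≤
      Cγ * T := fun p =>
    abs_gradCov_one_add_sub_le_of_torusFRD (fun A hA => (Q.hallA A hA).2.2.2.2.1) hd2 P.hn2 hL1 hq'.1 hq.1
      hq'2 hq2 hkN1 p
  have hδγ0 : 0 ≤ Cγ * T := mul_nonneg hCγ0 hT0
  -- the pair suppliers at `(q, q')`
  obtain ⟨hdint, hdiffU⟩ := hsup N M Q q' q hq' hq k hk
  have hℓcT0 : 0 ≤ ℓc * T := mul_nonneg hℓc0 hT0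
  set ℓnf : Finset (Fin d → ZMod M) → ℝ := fun U => ℓn * esum (q - q') * Real.sqrt ((3 : ℝ) ^ (d + 1) * ((2 * (P.L * numBlocks (P.L ^ (k + 1)) U + 2 * (2 ^ (d + 1) + P.R) + 2 * P.pT + 1) : ℕ) : ℝ) ^ d) with hℓnfdef
  have hℓnf0 : ∀ U, 0 ≤ ℓnf U := fun U => by rw [hℓnfdef]; positivity
  have hℓnf : ∀ U : Finset (Fin d → ZMod M), ℓnf U * lamR ^ (blocks (P.L * P.L ^ k) U).card ≤ ℓn * Cn * T := by
    intro U
    have hcard : (blocks (P.L * P.L ^ k) U).card = numBlocks (P.L ^ (k + 1)) U := by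
      rw [card_blocks_eq_numBlocks, ← pow_succ']
    rw [hcard, hℓnfdef]
    have hcast : ((2 * (P.L * numBlocks (P.L ^ (k + 1)) U + 2 * (2 ^ (d + 1) + P.R) + 2 * P.pT + 1) : ℕ) : ℝ) =
        2 * ((P.L : ℝ) * (numBlocks (P.L ^ (k + 1)) U) + c₀) := by
      rw [hc₀def]; push_cast; ring
    have hsq := sqrt_poly_mul_geom_le_freeHt hL1 hc₀0 hlamR0.le hlamR1.le hC₁ (numBlocks (P.L ^ (k + 1)) U)
    rw [← hcast] at hsq
    calc ℓn * esum (q - q') * Real.sqrt ((3 : ℝ) ^ (d + 1) *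
            ((2 * (P.L * numBlocks (P.L ^ (k + 1)) U + 2 * (2 ^ (d + 1) + P.R) + 2 * P.pT + 1) : ℕ) : ℝ) ^ d) *
          lamR ^ numBlocks (P.L ^ (k + 1)) U
        = ℓn * T * (Real.sqrt ((3 : ℝ) ^ (d + 1) *
            ((2 * (P.L * numBlocks (P.L ^ (k + 1)) U + 2 * (2 ^ (d + 1) + P.R) + 2 * P.pT + 1) : ℕ) : ℝ) ^ d) *
          lamR ^ numBlocks (P.L ^ (k + 1)) U) := by rw [hTdef]; ring
      _ ≤ ℓn * T * Cn := mul_le_mul_of_nonneg_left hsq (mul_nonneg hℓn0 hT0)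
      _ = ℓn * Cn * T := by ring
  -- `Δ = ‖H̃_q − H̃_{q'}‖ ≤ ℓ_H |q−q'|₁ max(‖u‖, c_v) ≤ τ`
  have hΔ : hamNorm (fieldWt P.h (P.L : ℝ) d k) ((P.L : ℝ) ^ k) (P.L ^ (d * k)) (nextH Da H Kf - nextH Db H Kf) ≤
      ℓH * T * mx := hnextH N M Q q' q hq' hq k hk u v cv hv
  have hΔτ : hamNorm (fieldWt P.h (P.L : ℝ) d k) ((P.L : ℝ) ^ k) (P.L ^ (d * k)) (nextH Da H Kf - nextH Db H Kf) ≤ τ := by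
    have h1 : ℓH * T * mx ≤ ℓH * T₁ * P.r :=
      mul_le_mul (mul_le_mul_of_nonneg_left hT hℓH0) hmxr hmx0 (by positivity)
    have h2 : ℓH * T₁ * P.r ≤ 2 * P.r := mul_le_mul_of_nonneg_right hℓHT₁ P.hr0
    have h3 : 2 * P.r ≤ τ := by rw [hτdef]; linarith only [hvr0]
    exact hΔ.trans (h1.trans (h2.trans h3))
  -- the carriers
  have hvm : C87 * (mx * P.A𝒫' * P.A⁻¹) ≤ 1 / 64 := by
    have : C87 * (mx * P.A𝒫' * P.A⁻¹) ≤ vr := by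
      rw [hvr']
      exact mul_le_mul_of_nonneg_left (mul_le_mul_of_nonneg_right
        (mul_le_mul_of_nonneg_right hmxr hA𝒫0) (inv_nonneg.2 hA0.le)) hC87_0
    exact this.trans P.hv
  have hτm : 2 * mx + C87 * (mx * P.A𝒫' * P.A⁻¹) ≤ τ := by
    have : C87 * (mx * P.A𝒫' * P.A⁻¹) ≤ vr := by
      rw [hvr']
      exact mul_le_mul_of_nonneg_left (mul_le_mul_of_nonneg_right
        (mul_le_mul_of_nonneg_right hmxr hA𝒫0) (inv_nonneg.2 hA0.le)) hC87_0
    rw [hτdef]; linarith only [this, hmxr]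
  have hτ16 : τ ≤ 1 / 16 := by
    rw [hτdef, hvr]; have := P.hr; have := P.hv; linarith only [‹P.r ≤ 1 / 64›, ‹vABKM d P.R P.A P.A𝒫' P.r ≤ 1 / 64›]
  have hexp14 : 1 ≤ Real.exp (1 / 4 : ℝ) := Real.one_le_exp (by norm_num)
  -- norms: `‖H̃_q‖ ≤ τ`, `‖H̃‖ ≤ τ + ρ₀`
  have hL0r' : (0 : ℝ) < P.L := by exact_mod_cast P.hLodd.pos
  have h𝔥 : 0 < fieldWt P.h (P.L : ℝ) d k := fieldWt_pos P.hh hL0r' d k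
  have hRk : (0 : ℝ) < (P.L : ℝ) ^ k := pow_pos hL0r' k
  have hHr : hamNorm (fieldWt P.h (P.L : ℝ) d k) ((P.L : ℝ) ^ k) (P.L ^ (d * k)) H ≤ P.r := by rw [hnormu]; exact hu
  have hKr : WeakNormLE Q.normParams k Kf P.r := hKw.mono hPA hcv
  have hHta : hamNorm (fieldWt P.h (P.L : ℝ) d k) ((P.L : ℝ) ^ k) (P.L ^ (d * k)) (nextH Da H Kf) ≤ τ := by
    have h := hamNorm_nextH_abkm_le_of_stepKernelBounds hd2 P.hLodd P.hL Q.hM hk (by have := P.hp; omega)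
      (by have := P.hpM; have := P.hMR; omega) (by have := P.hr₀; omega) Q.hB P.hh P.hh2 P.hA1 Da hSa (x₀ := 0) rfl rfl H
      P.hr0 hKr hKd hKloc
    rw [hτdef, hvr']
    linarith [h, hHr]
  have hHt' : hamNorm (fieldWt P.h (P.L : ℝ) d k) ((P.L : ℝ) ^ k) (P.L ^ (d * k)) Ht ≤ τ + ρ₀ := by
    have h := hamNorm_add_le h𝔥.le hRk.le (P.L ^ (d * k)) (Ht - nextH Da H Kf) (nextH Da H Kf)
    rw [sub_add_cancel] at h
    linarith [h, hHta, hHt]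
  have hexp_le : Real.exp (1 / 4 : ℝ) ≤ Real.exp (3 / 8) := Real.exp_le_exp.2 (by norm_num)
  have he38 : 0 < Real.exp (3 / 8 : ℝ) := Real.exp_pos _
  have h16ρ : 16 * Real.exp (3 / 8) * ρ₀ ≤ 16 * Real.exp (3 / 8) * τ := mul_le_mul_of_nonneg_left hρ₀τ (by positivity)
  have h8ρ : 8 * Real.exp (1 / 4) * ρ₀ ≤ 16 * Real.exp (3 / 8) * ρ₀ := by
    have : 8 * Real.exp (1 / 4) ≤ 16 * Real.exp (3 / 8) := by linarith [hexp_le, he38]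
    exact mul_le_mul_of_nonneg_right this hρ₀0.le
  have hτm' : 2 * mx + C87 * (mx * P.A𝒫' * P.A⁻¹) ≤ τ + ρ₀ := by linarith [hτm, hρ₀0]
  have hτ16' : τ + ρ₀ ≤ 1 / 16 := by linarith [hτ364, hρ₀64]
  have hω1 : 8 * Real.exp (1 / 4) * (τ + ρ₀) ≤ ω := by
    rw [hω, hsdef]; linarith [h16ρ, h8ρ]
  have hκ' : 1 + Real.exp (1 / 4) ≤ κm := by rw [hκmdef, hκbdef]; linarith [hs0]
  have hκ₁' : 1 + Real.exp (1 / 4) + 16 * Real.exp (3 / 8) * (τ + ρ₀) ≤ κA := by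
    rw [hκA, hκmdef, hκbdef, hsdef]; linarith [h16ρ]
  have hω2 : 8 * Real.exp (1 / 4) * mx + 8 * Real.exp (1 / 4) * mx ≤ ω := by
    rw [hω]
    have h1 : 8 * Real.exp (1 / 4) * mx ≤ 8 * Real.exp (1 / 4) * P.r := by gcongr
    have h2 : 2 * P.r ≤ τ := by rw [hτdef]; linarith only [hvr0]
    have h3 : 0 ≤ Real.exp (1 / 4 : ℝ) := (Real.exp_pos _).le
    have h4 : 8 * Real.exp (1 / 4) * (2 * P.r) ≤ 8 * Real.exp (1 / 4) * τ := mul_le_mul_of_nonneg_left h2 (by positivity)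
    nlinarith only [h1, h4, hs0, h3]
  have hω3 : mx + mx ≤ ω := by
    rw [hω]
    have h2 : 2 * P.r ≤ τ := by rw [hτdef]; linarith only [hvr0]
    have h4 : τ ≤ 8 * Real.exp (1 / 4) * τ := by nlinarith only [hexp14, hτ0]
    linarith only [hmxr, h2, h4, hs0]
  -- the kernel-level weak bound at the common free `H̃`
  have hW := weakNormLE_nextK_freeHt_kernel_sub_abkm_of_stepKernelBounds P.hd P.hLodd P.hL P.hR2 Q.hM hk P.hp P.hpM P.hMR P.hr₀ Q.hB P.hδ₀ P.hδ₁ P.hh P.hh0 P.hh2 P.hh2 P.A𝒫'_nonneg P.A𝒫'_nonneg P.hA1 hκc0 hκcA hsmallc Da Db rfl rfl rfl rfl hSa hSb (x₀ := 0) rfl rfl rfl rfl hδγ0 hγab hℓcT0 hdint hκp0 (ℓnf := ℓnf) (ℓbar := ℓn * Cn * T) (lamR := lamR) hℓnf0 hℓnf hlamR0.le hlamR1.le hdiffU hHm hm64 hmx0 hKm (factorises_mulExt hk1) (fun φ => mulExt_empty φ) hKd hKloc hKt hvm hvm hτm' hτm' hτ16' hHt' (ω := ω) (κ := κm) (κ₁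 := κA) hω1 hω2 hω3 P.hωA hκ' hκ₁' hc3b hc2b
  refine hW.mono hPA ?_
  -- clean the bound: `‖H − H‖ = 0`, the vanishing letters
  rw [← hC87]
  -- every term carries a factor `T · max(‖u‖, c_v)`: enlarge the other small letters to package constants
  refine le_trans (b := mx * ((P.L : ℝ) ^ d * (ℓc * T * κc * abkmContrConst d P.L P.R) + ℓc * T * largePartEps d P.L P.A κc (1 + 1 / ((2 * (2 ^ d + 1) + 6 : ℝ) ^ d)) + ℓc * T * largePartEps d P.L P.A κc (1 + 1 / ((2 * (2 ^ d + 1) + 6 : ℝ) ^ d))) + ((P.L ^ d : ℕ) : ℝ) * κA ^ (P.L ^ d) * (16 * Real.exp (3 / 8) * (τ + ρ₀) * ((1 + 8 * C87) * (mx * (ℓc * T) * κc * P.A⁻¹)) + (512 * Real.exp (1 / 4) * (P.r * (C87 * (mx * (ℓc * T) * κc * P.A⁻¹))) + 256 * Real.exp (1 / 4) * (C87 * (P.r * P.A𝒫' * P.A⁻¹) + C87 * (P.r * (ℓc * T₁) * κc * P.A⁻¹)) * (C87 * (mx * (ℓc * T) * κc * P.A⁻¹)) + (8 * Real.exp (1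 / 4) * mx * (ℓc * T) * κc + 16 * Real.exp (3 / 8) * (Cγ * T / P.h ^ 2 * mx) + 256 * Real.exp (1 / 4) * (2 * (Cγ * T / P.h ^ 2 * mx)) * (C87 * (P.r * P.A𝒫' * P.A⁻¹))))) * P.A + ℓn * Cn * T * ((8 * Real.exp (1 / 4) * mx + mx) * (ω * P.A ^ 4) + mx) + ℓn * Cn * T * ((8 * Real.exp (1 / 4) * mx + mx) * (ω * P.A ^ 4)) + ℓn * Cn * T * ((8 * Real.exp (1 / 4) * mx + mx) * (ω * P.A ^ 4)) + ((P.L ^ d : ℕ) : ℝ) * κA ^ (P.L ^ d) * (16 * Real.exp (3 / 8) * (ℓH * T * mx)) * P.A) ?_ (le_of_eq ?_)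
  · gcongr
  · rw [hlNdef]; ring

end Summit.HubbardSuperconductivity.HubbardSuperconductivity.Theorems.ComplexGFF

end
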